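import Summits.AtomisticToContinuum.HydrodynamicLimit.Theses.CollisionIsometryCLT

/-!
# Line `ballistic-tubes` — skeleton for the crux `CollisionIsometryCLT.DiffuseBackwardInfluence`
(crux item stmt-AtomisticToContinuum-12950, rank 3; route `route-AtomisticToContinuum-CollisionIsometryCLT`)

Crux (FIXED, by name): for all continuous positive profiles `∃ σ₀ ∀ σ < σ₀ ∀ Φ ∀ Δ_N`
(`Δ_N > 0`, `Δ_N → 0`, `Δ_N (N+1)^{1/3} → ∞`) `∀ t > 0`:
`E_localGibbs[ipr N (Φ_{t−Δ_N} z) Δ_N] → 0`, `ipr = (N+1)⁻¹ Σᵢ Σₖ ‖M_ik‖_F⁴ ∈ [9/(N+1), 9]` the mean inverse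
participation ratio of the rows of the frozen-geometry velocity transfer `M` over the window.

Idea (crux idea `ballistic-tubes`, triage r1 k1: pass; card body not mounted in this seat — worked from its
item-evidence abstract and the triager's reconstruction TRIAGE-r1-1.md). A particle with no collision on a time
slot flies STRAIGHT, so "≥ η(N+1) particles are collision-poor (≤ m own collisions) on the window" is contained,
by pigeonhole over the m+1 slots and stationarity of the homogeneous Gibbs law `G_N`, in a STATIC one-time event:
"some η(N+1)/(m+1) particles have pairwise ε-separated straight space–time tubes for time Δ_N/(m+1)". Its Gibbs
cost is velocity coherence, `≈ 3η'(N+1)·log n_N` nats with `n_N ≍ σ²Δ_N(N+1)^{1/3} → ∞` — SUPER-exponential.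
That is exactly the currency in which the O(N) relative entropy of the local Gibbs law w.r.t. `G_N`
(Kipnis–Landim A1 Prop 8.2, tree fact `Literature.Probability.Entropy.KipnisLandim1999_A1_8_2_holds`) transfers an
EQUILIBRIUM estimate to the crux's non-equilibrium time-`(t−Δ_N)` law with no dynamics along the way. The line:

  entropy transfer (stub 2) ∘ Gibbs invariance (stub 1) ∘ [ equilibrium super-exponential delocalisation
    ⇐ no-reconcentration (stub 5, conditional on ↓) ⇐ few-collisions-are-super-exp-rare (stub 4) ⇐ tube LD (stub 3) ].

## Stubs (5, registered; all stated over existing Literature / route declarations only — the crux's own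
`let M …; let ipr …` prefix verbatim, plus one more inlined `let ownColl …` = number of own collisions of
particle `i` among the folded collision steps)
* `stub_gibbsInvariance`     — VERBATIM the shared support item `GibbsInvariance` (stmt-AtomisticToContinuum-9239,
  wanted by 5 routes, two sorry-free candidate proofs attached there): `Φ_t` preserves `G_N = localGibbsLaw σ 1 0 θe`
  (S–M, provable-now).
* `stub_entropyTransfer`     — super-exponentially `G_N`-rare events of a bounded functional are negligible in
  local-Gibbs MEAN: `0 ≤ F_N ≤ B`, `G_N{δ < F_N} ≤ e^{−c(N+1)} ∀δ ∀c ∀ᶠN` ⇒ `E_localGibbs[F_N] → 0`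
  (M; = FrostBudget stmt-9237 `H(localGibbs | G_N) ≤ C(N+1)` + Kipnis–Landim A1.8.2 (proved in tree) + plumbing).
* `stub_tubeNonCrossingLD`   — THE LEVER of this idea (L–XL): for `τ_N (N+1)^{1/3} → ∞`, every fixed `S`,
  `|S| ≥ η(N+1)`: `G_N(straight tubes of S pairwise ε-separated on [0, τ_N]) ≤ e^{−c(N+1)}` for every `c`,
  eventually in `N` — a static stochastic-geometry large deviation (velocity coherence is the cheapest strategy).
* `stub_fewCollisionsOfTubes`— kinematic reduction (M–L): invariance + tube LD ⇒ for every admissible window and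
  every `m`, `η`: `G_N(≥ η(N+1) particles with ≤ m own collisions in [0, Δ_N]) ≤ e^{−c(N+1)} ∀c ∀ᶠN`
  (Alexander construction: no own collision on a slot ⇒ free flight; pigeonhole; hard core along the flow;
  union over slots and subsets).
* `stub_noReconcentration`   — HARDEST (XL, open; NOT this idea's lever — the triage's "missing NoReconcentration
  half"): given invariance and the few-collisions bound for all admissible windows, the full equilibrium
  super-exponential delocalisation `G_N{δ < ipr N y Δ_N} ≤ e^{−c(N+1)} ∀δ ∀c ∀ᶠN`.
* `DiffuseBackwardInfluence_of : TransferIsometry → stub₁ → … → stub₅ → DiffuseBackwardInfluence` — the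
  kernel-checked composition (real proof): thresholds `σ₀ := min (min σ₁ σ₂) (min σ₃ ½)`; few-collisions from
  stubs 1+3+4; the super-exponential bound from stub 5; transport of the time-`(t−Δ_N)` event to a `G_N`-event by
  invariance (`Measure.le_map_apply`, glue `measure_setOf_comp_le_of_le`); `0 ≤ ipr ≤ 9` from the route's support item `TransferIsometry`
  (stmt-AtomisticToContinuum-12951, provable-now) BY NAME (row budget `Σₖ‖M_ik‖_F² = 3` ⇒ `iprᵢ ≤ 9`); then stub 2
  with `F_N z := ipr N (Φ_{t−Δ_N} z) Δ_N`, `B := 9`.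

## Disproof used
No `Disproof.lean` exists for this crux at planning time (payload `disproof_path` not present; `ledger crux ls`
lists only TRIAGE-r1-1.md; no `Negative/` lemma landed): nothing to honour or import. Negatives index checked
(12 refuted statements of the summit): the two nearby patterns are answered — (i) `EulerCharacteristics.ExpTailBudget`
(stmt-14607, one Gaussian outlier beats `e^{−cN}`): every event here counts a FRACTION `η(N+1)` of particles or
thresholds the MEAN `ipr ≤ 9` of per-particle quantities in `[0, 9]`, so no single-particle outlier moves it;
(ii) `WarmColdDichotomy.ColdIsRare` (stmt-9236, small sub-populations vacuously "cold"): all cardinality floors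
here are `η(N+1)` with `η > 0` fixed BEFORE `∀ᶠ N`, so degenerate small `S` occur for finitely many `N` only.
-/

namespace Summit.AtomisticToContinuum.HydrodynamicLimit.Cruxes.DiffuseBackwardInfluence.BallisticTubes

open scoped Topology Classical ENNReal
open Filter Set MeasureTheory

/-! ## Stub 1 — invariance of the homogeneous Gibbs law (shared support `GibbsInvariance`) -/

/-- STUB 1 (size S–M, provable-now; = shared support item `GibbsInvariance`, stmt-AtomisticToContinuum-9239,
VERBATIM — candidate sorry-free proofs `Proof9239.lean` / `ProofGibbsInvariance9239.lean` are attached to that item;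
sources: Alexander1975, CIP1994 §4.2 (Liouville measure preservation: structure field
`HardSphereFlow.measurePreserving`), energy conservation `IsHardSphereTrajectory.configEnergy_eq_holds`, good set
conull and invariant). **Gibbs invariance.** For every `σ, θe, N`, every hard-sphere flow `Φ` and every `t`, the
flow map `Φ_t` preserves the homogeneous canonical law `G_N = localGibbsLaw σ 1 0 θe N Φ` (density = function of
the conserved kinetic energy times the indicator of the invariant hard-sphere domain; junk `σ` gives the zero
measure, trivially preserved). Used at `θe = 1`. -/
theorem stub_gibbsInvariance :
    ∀ (σ θe : ℝ) (N : ℕ) (Φ : Literature.Analysis.FluidPDE.HardSphereFlow (Literature.Analysis.FluidPDE.Torus.geometry (Fin 3)) (Literature.MathematicalPhysics.KineticTheory.hsDiameter σ N) (N + 1)) (t : ℝ), 0 < θe → MeasureTheory.MeasurePreserving (Φ.flow t) (Literature.MathematicalPhysics.KineticTheory.localGibbsLaw σ (fun _ => 1) (fun _ => 0) (fun _ => θe) N Φ) (Literature.MathematicalPhysics.KineticTheory.localGibbsLaw σ (fun _ => 1) (fun _ => 0) (fun _ => θe) N Φ) := by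
  sorry

/-! ## Stub 2 — the entropy transfer (equilibrium super-exponential ⇒ local-Gibbs negligible) -/

/-- STUB 2 (size M; sources: KipnisLandim1999 App. 1 Prop. 8.2 p. 338 — tree fact
`Literature.Probability.Entropy.KipnisLandim1999_A1_8_2_holds` (PROVED); the entropy budget
`H(localGibbsLaw σ a₀ u₀ θ₀ N | localGibbsLaw σ 1 0 1 N) ≤ C(N+1)` is the open support item `FrostBudget`
(stmt-AtomisticToContinuum-9237, θe = 1; refuter-confirmed TRUE: Gaussian log-ratio + `log Z_G/Z_LG ≤ (N+1)log(1/inf a₀)`),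
`isProbabilityMeasure_localGibbsLaw` (σ ≤ 1/2), `localGibbsLaw_absolutelyContinuous`).
**Entropy transfer for bounded functionals.** For continuous positive profiles there is `σ₀ > 0` such that for
`0 < σ < σ₀`, every flow family and every family of functionals `0 ≤ F_N ≤ B` of the INITIAL configuration: if
for every `δ > 0` the events `{δ < F_N}` are super-exponentially rare under the homogeneous Gibbs law
(`≤ e^{−c(N+1)}` for every `c`, eventually in `N`), then `∫ F_N d(localGibbsLaw) → 0`.
Proof sketch: `P(A) ≤ P(A') ≤ (log 2 + C(N+1)) / log(1 + 1/G(A')) ≤ 2C/c` with `A' = toMeasurable G A ⊇ A`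
(no measurability of `F` needed), then `∫⁻ F ≤ δ + B·P{δ < F}`; `c`, `δ` arbitrary. -/
theorem stub_entropyTransfer :
    ∀ (a₀ θ₀ : (UnitAddTorus (Fin 3)) → ℝ) (u₀ : (UnitAddTorus (Fin 3)) → (EuclideanSpace ℝ (Fin 3))), Continuous a₀ → Continuous θ₀ → Continuous u₀ → (∀ x, 0 < a₀ x) → (∀ x, 0 < θ₀ x) → ∃ σ₀ : ℝ, 0 < σ₀ ∧ ∀ σ : ℝ, 0 < σ → σ < σ₀ → ∀ Φ : (N : ℕ) → Literature.Analysis.FluidPDE.HardSphereFlow (Literature.Analysis.FluidPDE.Torus.geometry (Fin 3)) (Literature.MathematicalPhysics.KineticTheory.hsDiameter σ N) (N + 1), ∀ (F : (N : ℕ) → Literature.Analysis.FluidPDE.Config (N + 1) (Fin 3) (UnitAddTorus (Fin 3)) → ℝ) (B : ℝ), (∀ N z, 0 ≤ F N z) → (∀ N z, F N z ≤ B) → (∀ δ : ℝ, 0 < δ → ∀ c : ℝ, ∀ᶠ N : ℕ in atTop, Literature.MathematicalPhysics.KineticTheory.localGibbsLaw σ (fun _ => 1) (fun _ => 0) (fun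 _ => 1) N (Φ N) {z : Literature.Analysis.FluidPDE.Config (N + 1) (Fin 3) (UnitAddTorus (Fin 3)) | δ < F N z} ≤ ENNReal.ofReal (Real.exp (-(c * ((N + 1 : ℕ) : ℝ))))) → Tendsto (fun N : ℕ => ∫⁻ z, ENNReal.ofReal (F N z) ∂(Literature.MathematicalPhysics.KineticTheory.localGibbsLaw σ a₀ u₀ θ₀ N (Φ N))) atTop (𝓝 0) := by
  sorry

/-! ## Stub 3 — THE LEVER: the static tube non-crossing large deviation -/

/-- STUB 3 — LOAD-BEARING FOR THIS IDEA (size L on paper, XL in Lean; sources: the idea card `ballistic-tubes`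
(cost of velocity coherence `≈ 3η(N+1) log n_τ`, `n_τ = σ²τ_N(N+1)^{1/3} → ∞`; reproduced independently in
TRIAGE-r1-1), hard-core conditioning costs only `e^{O(N)}` (`hsFreeVolume`, Ruelle1969 §3.4) so the estimate may be
proved for the IDEAL gas (independent uniform positions, Maxwellian velocities: `idealGasState` of
`Literature/Barriers/AtomisticToContinuum/BoltzmannHypothesis.lean`), swept-volume / Boltzmann collision-cylinder geometry CIP1994 §2, GST2013 §1.1;
nearest printed LD technology: Janson-type lower tails give only `e^{−cηN}` (EXPONENTIAL) and do NOT suffice — the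
proof must price the collective velocity coherence (an LD lower bound for the relative kinetic energy of `η(N+1)`
particles whose tubes are mutually avoiding), which is new).
**Tube non-crossing LD (fixed `S`).** There is `σ₀ > 0` such that for `0 < σ < σ₀` and every sequence of tube
lengths `τ_N > 0` with `τ_N (N+1)^{1/3} → ∞` (many would-be collisions per particle), every `η > 0` and every `c`:
eventually in `N`, for every flow `Φ` (dummy: the law does not depend on it) and EVERY index set `S` with
`|S| ≥ η(N+1)`, the homogeneous Gibbs probability that the straight tubes `r ↦ xᵢ + r vᵢ`, `r ∈ [0, τ_N]`, of the
particles of `S` stay pairwise at minimal-image distance `≥ ε_N = hsDiameter σ N` is `≤ exp(−c(N+1))`.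
(The `∃ S` union over `≤ 2^{N+1}` subsets is free in this currency and is taken in stub 4.)
Why it might fail: only through an exponential-cost (`e^{−O(N)}`) velocity–position pattern of `η(N+1)` particles
with no mutual tube crossing; lanes / planar layers / Hubble-type expanding patterns all cost `≥ η(N+1)·log n_τ`
(checked on paper), but the `log n_τ` margin is thin. -/
theorem stub_tubeNonCrossingLD :
    ∃ σ₀ : ℝ, 0 < σ₀ ∧ ∀ σ : ℝ, 0 < σ → σ < σ₀ → (∀ τ : ℕ → ℝ, (∀ N, 0 < τ N) → Tendsto (fun N : ℕ => τ N * ((N + 1 : ℕ) : ℝ) ^ ((1 : ℝ) / 3)) atTop atTop → ∀ η : ℝ, 0 < η → ∀ c : ℝ, ∀ᶠ N : ℕ in atTop, ∀ (Φ : Literature.Analysis.FluidPDE.HardSphereFlow (Literature.Analysis.FluidPDE.Torus.geometry (Fin 3)) (Literature.MathematicalPhysics.KineticTheory.hsDiameter σ N) (N + 1)) (S : Finset (Fin (N + 1))), η * ((N + 1 : ℕ) : ℝ) ≤ (S.card : ℝ) → Literature.MathematicalPhysics.KineticTheory.localGibbsLaw σ (fun _ => 1) (fun _ => 0) (fun _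 => 1) N Φ {z : Literature.Analysis.FluidPDE.Config (N + 1) (Fin 3) (UnitAddTorus (Fin 3)) | ∀ i ∈ S, ∀ j ∈ S, i ≠ j → ∀ r ∈ Set.Icc (0 : ℝ) (τ N), Literature.MathematicalPhysics.KineticTheory.hsDiameter σ N ≤ ‖(Literature.Analysis.FluidPDE.Torus.geometry (Fin 3)).sepVec (Literature.Analysis.FluidPDE.freeFlight (Literature.Analysis.FluidPDE.Torus.geometry (Fin 3)) r z i).1 (Literature.Analysis.FluidPDE.freeFlight (Literature.Analysis.FluidPDE.Torus.geometry (Fin 3)) r z j).1‖} ≤ ENNReal.ofReal (Real.exp (-(c * ((N + 1 : ℕ) : ℝ))))) := by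
  sorry

/-! ## Stub 4 — kinematic reduction: few collisions ⇒ a free slot ⇒ non-crossing tubes -/

/-- STUB 4 (size M–L; sources: Alexander1975 / CIP1994 App. 4.A as formalised in
`Literature.Analysis.FluidPDE.HardSphereFlowConstruction` (`Alexander.stateAfter`, `collisionInstant`,
`collisionCount`, `fwdFlow`, `good`, `collidePair_apply_of_ne`, the five `torusFlow_*` facts and
`HardSphereFlow.nonempty_torus_of_construction`), `HardSphereFlow.good_subset`/`mapsTo_good` (hard core along the
flow), `Measure.le_map_apply` + stub 1 (stationarity), `measure_biUnion_finset_le` (union bounds)).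
**Few collisions are super-exponentially rare, from tubes.** Fix `0 < σ < 1/2`. Assume Gibbs invariance at `σ`
(stub 1 at `θe = 1`) and the tube LD at `σ` (stub 3). Then for every window sequence `Δ_N > 0` with
`Δ_N (N+1)^{1/3} → ∞`, every `m : ℕ`, `η > 0` and `c`: eventually in `N`, for every flow `Φ`,
`G_N{y | η(N+1) ≤ #{i | ownColl N y Δ_N i ≤ m}} ≤ exp(−c(N+1))`, where `ownColl N y Δ i` counts the collision
steps `k < collisionCount y Δ_N` of the Alexander dynamics started at `y` whose colliding pair contains `i`
(exactly the steps at which row `i` of the crux's transfer `M` is updated).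
Proof sketch: on the (conull, invariant) good set, `≤ m` own instants in `(0, Δ_N]` miss one of the `m+1` open
slots of length `τ_N = Δ_N/(m+1)`; on it particle `i` moves by free flight (`collidePair_apply_of_ne` across the
steps not involving `i`), and two such particles stay `≥ ε` apart (flow ⊆ hard-sphere domain); so the event lies in
`⋃_{j ≤ m} (Φ_A.flow (jτ_N))⁻¹ {∃ S, |S| ≥ η(N+1)/(m+1), tubes of S separated on [0, τ_N]}`, `Φ_A` the Alexander
flow; invariance moves each slot to time 0, and `(m+1)·2^{N+1}·e^{−(c+2)(N+1)} ≤ e^{−c(N+1)}` eventually. -/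
theorem stub_fewCollisionsOfTubes :
    ∀ σ : ℝ, 0 < σ → σ < 2⁻¹ → (∀ (N : ℕ) (Φ : Literature.Analysis.FluidPDE.HardSphereFlow (Literature.Analysis.FluidPDE.Torus.geometry (Fin 3)) (Literature.MathematicalPhysics.KineticTheory.hsDiameter σ N) (N + 1)) (t : ℝ), MeasureTheory.MeasurePreserving (Φ.flow t) (Literature.MathematicalPhysics.KineticTheory.localGibbsLaw σ (fun _ => 1) (fun _ => 0) (fun _ => 1) N Φ) (Literature.MathematicalPhysics.KineticTheory.localGibbsLaw σ (fun _ => 1) (fun _ => 0) (fun _ => 1) N Φ)) → (∀ τ : ℕ → ℝ, (∀ N, 0 < τ N) → Tendsto (fun N : ℕ => τ N * ((N + 1 : ℕ) : ℝ) ^ ((1 : ℝ) / 3)) atTop atTop → ∀ η : ℝ, 0 < η → ∀ c : ℝ, ∀ᶠ N : ℕ in atTop, ∀ (Φ : Literature.Analysis.FluidPDE.HardSphereFlow (Literature.Analysis.FluidPDE.Torus.geometry (Fin 3)) (Literature.MathematicalPhysics.KineticTheory.hsDiameter σ N) (N + 1)) (S : Finset (Fin (N + 1))), η * ((N + 1 :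 ℕ) : ℝ) ≤ (S.card : ℝ) → Literature.MathematicalPhysics.KineticTheory.localGibbsLaw σ (fun _ => 1) (fun _ => 0) (fun _ => 1) N Φ {z : Literature.Analysis.FluidPDE.Config (N + 1) (Fin 3) (UnitAddTorus (Fin 3)) | ∀ i ∈ S, ∀ j ∈ S, i ≠ j → ∀ r ∈ Set.Icc (0 : ℝ) (τ N), Literature.MathematicalPhysics.KineticTheory.hsDiameter σ N ≤ ‖(Literature.Analysis.FluidPDE.Torus.geometry (Fin 3)).sepVec (Literature.Analysis.FluidPDE.freeFlight (Literature.Analysis.FluidPDE.Torus.geometry (Fin 3)) r z i).1 (Literature.Analysis.FluidPDE.freeFlight (Literature.Analysis.FluidPDE.Torus.geometry (Fin 3)) r z j).1‖} ≤ ENNReal.ofReal (Real.exp (-(c * ((N + 1 : ℕ) : ℝ))))) → let ownColl := fun (N : ℕ) (y : Literature.Analysis.FluidPDE.Config (N + 1) (Fin 3) (UnitAddTorus (Fin 3))) (Δ : ℝ) (i : Fin (N + 1)) => (let G := Literature.Analysis.FluidPDE.Torus.geometry (Fin 3); let ε : ℝ := Literature.MathematicalPhysics.KineticTheory.hsDiameter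 σ N; let pre := fun k : ℕ => (let zk := Literature.Analysis.FluidPDE.Alexander.stateAfter G ε y k; Literature.Analysis.FluidPDE.freeFlight G (Literature.Analysis.FluidPDE.Alexander.freeExitTime G ε zk).toReal zk); ((Finset.range (Literature.Analysis.FluidPDE.Alexander.collisionCount G ε y Δ)).filter (fun k => ∃ h : (Literature.Analysis.FluidPDE.Alexander.incomingPairs G ε (pre k)).Nonempty, h.some.1 = i ∨ h.some.2 = i)).card); ∀ Δ : ℕ → ℝ, (∀ N, 0 < Δ N) → Tendsto (fun N : ℕ => Δ N * ((N + 1 : ℕ) : ℝ) ^ ((1 : ℝ) / 3)) atTop atTop → ∀ (m : ℕ) (η : ℝ), 0 < η → ∀ c : ℝ, ∀ᶠ N : ℕ in atTop, ∀ Φ : Literature.Analysis.FluidPDE.HardSphereFlow (Literature.Analysis.FluidPDE.Torus.geometry (Fin 3)) (Literature.MathematicalPhysics.KineticTheory.hsDiameter σ N) (N + 1), Literature.MathematicalPhysics.KineticTheory.localGibbsLaw σ (fun _ => 1) (fun _ => 0) (fun _ => 1) N Φ {y : Literature.Analysis.FluidPDE.Config (N + 1) (Fin 3) (UnitAddTorus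 (Fin 3)) | η * ((N + 1 : ℕ) : ℝ) ≤ ((Finset.univ.filter (fun i : Fin (N + 1) => ownColl N y (Δ N) i ≤ m)).card : ℝ)} ≤ ENNReal.ofReal (Real.exp (-(c * ((N + 1 : ℕ) : ℝ)))) := by
  sorry

/-! ## Stub 5 — HARDEST: no reconcentration (conditional equilibrium super-exponential delocalisation) -/

/-- STUB 5 — HARDEST, OPEN; not this idea's lever (size XL; sources: the exact per-collision bookkeeping of the
transfer — crux ideas `kinship-lyapunov` / `two-walker-gain-identity` (KinshipProof.lean / GainProof.lean rc0 on the
item: `Δ(iprᵢ+iprⱼ) = Σₖ 2(xₖ−yₖ)((xₖ−yₖ)−(aₖ−bₖ))`, ℓ⁴ Lyapunov on cycle-free histories, kinship bound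
`≤ 2√(iprᵢ iprⱼ)`), the isotropic contraction `E‖(I−P)A‖_F² = (2/3)‖A‖_F²` (route NUMBERS), the equilibrium toy
jobs j005153 / j006671 / j007319 (self-attached to the item), Burago–Ferleger–Kononenko uniform collision bounds
doi:10.2307/120962 (K balls collide ≤ f(K) times: closed kin clusters cannot host `m → ∞` collisions),
SimanyiSzasz1999 (hyperbolicity, qualitative)).
**No reconcentration.** There is `σ₀ > 0` such that for `0 < σ < σ₀`: IF `G_N` is flow-invariant (stub 1) and IF
for every admissible window, every `m` and `η > 0` the event "≥ η(N+1) particles have ≤ m own collisions" is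
super-exponentially `G_N`-rare (the conclusion of stub 4, verbatim), THEN for every admissible window `Δ_N`
(`> 0`, `→ 0`, `Δ_N(N+1)^{1/3} → ∞`), every `δ > 0` and every `c`: eventually in `N`, for every flow `Φ`,
`G_N{y | δ < ipr N y Δ_N} ≤ exp(−c(N+1))` — the rows of the transfer are super-exponentially surely delocalised
at equilibrium. (`M`, `ipr` are the crux's lets verbatim; `ownColl` as in stub 4.)
Content left to the prover (quantifier order is the point: `m = m(δ, c)` may grow with `c`): `ipr > δ` forces
`≥ (δ/18)(N+1)` rows with `iprᵢ > δ/2`; all but `η(N+1)` of them have `> m` own collisions, so each either met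
`≥ θm` near-degenerate (normal, block) configurations (Gibbs cost `∝ m` per particle ⇒ `∝ δ m (N+1) > c(N+1)` for
`m` large) or inherited concentration from a concentrated partner within its last `O(log(1/δ))` collisions
(contagion chains must end at a source: a collision-poor particle — priced by the hypothesis on a sub-window via
invariance — or a degenerate history).
Why it might fail: an EXPONENTIAL-cost (`e^{−O(N)}`, not super-exponential) collective pattern keeping `δ'(N+1)`
rows concentrated although every particle collides `> m` times for every `m` (kin-recollision structures beyond
BFK-type bounds on the torus, or a contagion cascade from `o(N)` sources) would make the super-exponential
currency unaffordable and kill THIS LINE (the crux itself could survive in expectation). -/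
theorem stub_noReconcentration :
    ∃ σ₀ : ℝ, 0 < σ₀ ∧ ∀ σ : ℝ, 0 < σ → σ < σ₀ → (∀ (N : ℕ) (Φ : Literature.Analysis.FluidPDE.HardSphereFlow (Literature.Analysis.FluidPDE.Torus.geometry (Fin 3)) (Literature.MathematicalPhysics.KineticTheory.hsDiameter σ N) (N + 1)) (t : ℝ), MeasureTheory.MeasurePreserving (Φ.flow t) (Literature.MathematicalPhysics.KineticTheory.localGibbsLaw σ (fun _ => 1) (fun _ => 0) (fun _ => 1) N Φ) (Literature.MathematicalPhysics.KineticTheory.localGibbsLaw σ (fun _ => 1) (fun _ => 0) (fun _ => 1) N Φ)) → let M := fun (N : ℕ) (y : Literature.Analysis.FluidPDE.Config (N + 1) (Fin 3) (UnitAddTorus (Fin 3))) (Δ : ℝ) (W : Fin (N + 1) → EuclideanSpace ℝ (Fin 3)) => (let G := Literature.Analysis.FluidPDE.Torus.geometry (Fin 3); let ε : ℝ := Literature.MathematicalPhysics.KineticTheory.hsDiameter σ N; let pre := fun k : ℕ => (let zk := Literature.Analysis.FluidPDE.Alexander.stateAfter G ε y k; Literature.Analysis.FluidPDE.freeFlight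 G (Literature.Analysis.FluidPDE.Alexander.freeExitTime G ε zk).toReal zk); (List.range (Literature.Analysis.FluidPDE.Alexander.collisionCount G ε y Δ)).foldl (fun W' k => @dite (Fin (N + 1) → EuclideanSpace ℝ (Fin 3)) (Literature.Analysis.FluidPDE.Alexander.incomingPairs G ε (pre k)).Nonempty (Classical.propDecidable _) (fun h => fun i => (Literature.Analysis.FluidPDE.collidePair G h.some.1 h.some.2 (fun j => ((pre k j).1, W' j)) i).2) (fun _ => W')) W); let ipr := fun N y Δ => ((N + 1 : ℕ) : ℝ)⁻¹ * ∑ i : Fin (N + 1), ∑ k : Fin (N + 1), (∑ a : Fin 3, ‖M N y Δ (Pi.single k (EuclideanSpace.single a (1 : ℝ))) i‖ ^ 2) ^ 2; let ownColl := fun (N : ℕ) (y : Literature.Analysis.FluidPDE.Config (N + 1) (Fin 3) (UnitAddTorus (Fin 3))) (Δ : ℝ) (i : Fin (N + 1)) => (let G := Literature.Analysis.FluidPDE.Torus.geometry (Fin 3); let ε : ℝ := Literature.MathematicalPhysics.KineticTheory.hsDiameter σ N; let pre := fun k : ℕ => (let zk := Literature.Analysis.FluidPDE.Alexander.stateAfter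 G ε y k; Literature.Analysis.FluidPDE.freeFlight G (Literature.Analysis.FluidPDE.Alexander.freeExitTime G ε zk).toReal zk); ((Finset.range (Literature.Analysis.FluidPDE.Alexander.collisionCount G ε y Δ)).filter (fun k => ∃ h : (Literature.Analysis.FluidPDE.Alexander.incomingPairs G ε (pre k)).Nonempty, h.some.1 = i ∨ h.some.2 = i)).card); (∀ Δ : ℕ → ℝ, (∀ N, 0 < Δ N) → Tendsto (fun N : ℕ => Δ N * ((N + 1 : ℕ) : ℝ) ^ ((1 : ℝ) / 3)) atTop atTop → ∀ (m : ℕ) (η : ℝ), 0 < η → ∀ c : ℝ, ∀ᶠ N : ℕ in atTop, ∀ Φ : Literature.Analysis.FluidPDE.HardSphereFlow (Literature.Analysis.FluidPDE.Torus.geometry (Fin 3)) (Literature.MathematicalPhysics.KineticTheory.hsDiameter σ N) (N + 1), Literature.MathematicalPhysics.KineticTheory.localGibbsLaw σ (fun _ => 1) (fun _ => 0) (fun _ => 1) N Φ {y : Literature.Analysis.FluidPDE.Config (N + 1) (Fin 3) (UnitAddTorus (Fin 3)) | η * ((N + 1 : ℕ) : ℝ) ≤ ((Finset.univ.filter (fun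 i : Fin (N + 1) => ownColl N y (Δ N) i ≤ m)).card : ℝ)} ≤ ENNReal.ofReal (Real.exp (-(c * ((N + 1 : ℕ) : ℝ))))) → ∀ Δ : ℕ → ℝ, (∀ N, 0 < Δ N) → Tendsto Δ atTop (𝓝 0) → Tendsto (fun N : ℕ => Δ N * ((N + 1 : ℕ) : ℝ) ^ ((1 : ℝ) / 3)) atTop atTop → ∀ δ : ℝ, 0 < δ → ∀ c : ℝ, ∀ᶠ N : ℕ in atTop, ∀ Φ : Literature.Analysis.FluidPDE.HardSphereFlow (Literature.Analysis.FluidPDE.Torus.geometry (Fin 3)) (Literature.MathematicalPhysics.KineticTheory.hsDiameter σ N) (N + 1), Literature.MathematicalPhysics.KineticTheory.localGibbsLaw σ (fun _ => 1) (fun _ => 0) (fun _ => 1) N Φ {y : Literature.Analysis.FluidPDE.Config (N + 1) (Fin 3) (UnitAddTorus (Fin 3)) | δ < ipr N y (Δ N)} ≤ ENNReal.ofReal (Real.exp (-(c * ((N + 1 : ℕ) : ℝ)))) := by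
  sorry

/-! ## Proved glue -/

/-- Transport of an event along a measure-preserving self-map: if `map f μ = μ` and `μ{y | p y} ≤ b` then
`μ{x | p (f x)} ≤ b` (no measurability of the event needed: `Measure.le_map_apply`). [folklore] -/
theorem measure_setOf_comp_le_of_le {α : Type*} [MeasurableSpace α] {μ : Measure α} {f : α → α}
    (hf : Measurable f) (h : Measure.map f μ = μ) {p : α → Prop} {b : ℝ≥0∞} (hb : μ {y | p y} ≤ b) :
    μ {x | p (f x)} ≤ b := by
  calc μ {x | p (f x)} = μ (f ⁻¹' {y | p y}) := rfl
    _ ≤ Measure.map f μ {y | p y} := Measure.le_map_apply hf.aemeasurable _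
    _ = μ {y | p y} := by rw [h]
    _ ≤ b := hb

/-- Row budget `3` ⇒ mean inverse participation ratio `≤ 9`: for nonnegative block weights `wᵢₖ = Σₐ Rₖₐᵢ²` with
`Σₖ wᵢₖ = 3`, `Σₖ wᵢₖ² ≤ (Σₖ wᵢₖ)² = 9`, and the average over `i` of numbers `≤ 9` is `≤ 9`. [folklore] -/
theorem avg_ipr_le_nine {n : ℕ} (R : Fin (n + 1) → Fin 3 → Fin (n + 1) → ℝ)
    (h : ∀ i, ∑ k, ∑ a, R k a i ^ 2 = 3) :
    ((n + 1 : ℕ) : ℝ)⁻¹ * ∑ i, ∑ k, (∑ a, R k a i ^ 2) ^ 2 ≤ 9 := by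
  have hrow : ∀ i : Fin (n + 1), ∑ k, (∑ a, R k a i ^ 2) ^ 2 ≤ 9 := by
    intro i
    have hw : ∀ k : Fin (n + 1), 0 ≤ ∑ a, R k a i ^ 2 := fun k => Finset.sum_nonneg fun a _ => sq_nonneg _
    calc ∑ k, (∑ a, R k a i ^ 2) ^ 2 ≤ ∑ k, (∑ a, R k a i ^ 2) * ∑ l, ∑ a, R l a i ^ 2 := by
          refine Finset.sum_le_sum fun k _ => ?_
          rw [sq]
          exact mul_le_mul_of_nonneg_left
            (Finset.single_le_sum (fun l _ => hw l) (Finset.mem_univ k)) (hw k)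
      _ = (∑ k, ∑ a, R k a i ^ 2) ^ 2 := by rw [← Finset.sum_mul, sq]
      _ = 9 := by rw [h i]; norm_num
  have hn : (0 : ℝ) < ((n + 1 : ℕ) : ℝ) := by positivity
  calc ((n + 1 : ℕ) : ℝ)⁻¹ * ∑ i, ∑ k, (∑ a, R k a i ^ 2) ^ 2
      ≤ ((n + 1 : ℕ) : ℝ)⁻¹ * ∑ _i : Fin (n + 1), (9 : ℝ) :=
        mul_le_mul_of_nonneg_left (Finset.sum_le_sum fun i _ => hrow i) (inv_nonneg.mpr hn.le)
    _ = 9 := by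
        rw [Finset.sum_const, Finset.card_univ, Fintype.card_fin, nsmul_eq_mul, ← mul_assoc,
          inv_mul_cancel₀ hn.ne', one_mul]

/-! ## The composition: `TransferIsometry` (route support, by name) and the five stubs give the crux BY NAME -/

/-- **`DiffuseBackwardInfluence` from the line `ballistic-tubes`.** Pure bookkeeping, kernel-checked:
fix profiles; `σ₀ := min (min σ₁ σ₂) (min σ₃ ½)` from stubs 2, 3, 5; for `σ < σ₀` and an admissible window,
stub 4 (fed stub 1 at `θe = 1` and stub 3) gives the few-collisions bound for ALL admissible windows, stub 5 turns
it into `G_N{δ < ipr N y Δ_N} ≤ e^{−c(N+1)}`; invariance (stub 1, `Measure.le_map_apply`) transports the crux's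
time-`(t − Δ_N)` event `{z | δ < ipr N (Φ_{t−Δ_N} z) Δ_N}` onto it; `0 ≤ ipr ≤ 9` pointwise from the route's
support item `TransferIsometry` (stmt-AtomisticToContinuum-12951: row budget `3`, `avg_ipr_le_nine`); stub 2 with
`F_N z := ipr N (Φ_{t−Δ_N} z) Δ_N`, `B := 9` is the crux's conclusion. The crux decl and `TransferIsometry` are
matched through their common `let M …; let ipr …` prefix by ζ/β-reduction. -/
theorem DiffuseBackwardInfluence_of :
    Summit.AtomisticToContinuum.HydrodynamicLimit.Theses.CollisionIsometryCLT.TransferIsometry →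
    (∀ (σ θe : ℝ) (N : ℕ) (Φ : Literature.Analysis.FluidPDE.HardSphereFlow (Literature.Analysis.FluidPDE.Torus.geometry (Fin 3)) (Literature.MathematicalPhysics.KineticTheory.hsDiameter σ N) (N + 1)) (t : ℝ), 0 < θe → MeasureTheory.MeasurePreserving (Φ.flow t) (Literature.MathematicalPhysics.KineticTheory.localGibbsLaw σ (fun _ => 1) (fun _ => 0) (fun _ => θe) N Φ) (Literature.MathematicalPhysics.KineticTheory.localGibbsLaw σ (fun _ => 1) (fun _ => 0) (fun _ => θe) N Φ)) →
    (∀ (a₀ θ₀ : (UnitAddTorus (Fin 3)) → ℝ) (u₀ : (UnitAddTorus (Fin 3)) → (EuclideanSpace ℝ (Fin 3))), Continuous a₀ → Continuous θ₀ → Continuous u₀ → (∀ x, 0 < a₀ x) → (∀ x, 0 < θ₀ x) → ∃ σ₀ : ℝ, 0 < σ₀ ∧ ∀ σ : ℝ, 0 < σ → σ < σ₀ → ∀ Φ : (N : ℕ) → Literature.Analysis.FluidPDE.HardSphereFlow (Literature.Analysis.FluidPDE.Torus.geometry (Fin 3)) (Literature.MathematicalPhysics.KineticTheory.hsDiameter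 σ N) (N + 1), ∀ (F : (N : ℕ) → Literature.Analysis.FluidPDE.Config (N + 1) (Fin 3) (UnitAddTorus (Fin 3)) → ℝ) (B : ℝ), (∀ N z, 0 ≤ F N z) → (∀ N z, F N z ≤ B) → (∀ δ : ℝ, 0 < δ → ∀ c : ℝ, ∀ᶠ N : ℕ in atTop, Literature.MathematicalPhysics.KineticTheory.localGibbsLaw σ (fun _ => 1) (fun _ => 0) (fun _ => 1) N (Φ N) {z : Literature.Analysis.FluidPDE.Config (N + 1) (Fin 3) (UnitAddTorus (Fin 3)) | δ < F N z} ≤ ENNReal.ofReal (Real.exp (-(c * ((N + 1 : ℕ) : ℝ))))) → Tendsto (fun N : ℕ => ∫⁻ z, ENNReal.ofReal (F N z) ∂(Literature.MathematicalPhysics.KineticTheory.localGibbsLaw σ a₀ u₀ θ₀ N (Φ N))) atTop (𝓝 0)) →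
    (∃ σ₀ : ℝ, 0 < σ₀ ∧ ∀ σ : ℝ, 0 < σ → σ < σ₀ → (∀ τ : ℕ → ℝ, (∀ N, 0 < τ N) → Tendsto (fun N : ℕ => τ N * ((N + 1 : ℕ) : ℝ) ^ ((1 : ℝ) / 3)) atTop atTop → ∀ η : ℝ, 0 < η → ∀ c : ℝ, ∀ᶠ N : ℕ in atTop, ∀ (Φ : Literature.Analysis.FluidPDE.HardSphereFlow (Literature.Analysis.FluidPDE.Torus.geometry (Fin 3)) (Literature.MathematicalPhysics.KineticTheory.hsDiameter σ N) (N + 1)) (S : Finset (Fin (N + 1))), η * ((N + 1 : ℕ) : ℝ) ≤ (S.card : ℝ) → Literature.MathematicalPhysics.KineticTheory.localGibbsLaw σ (fun _ => 1) (fun _ => 0) (fun _ => 1) N Φ {z : Literature.Analysis.FluidPDE.Config (N + 1) (Fin 3) (UnitAddTorus (Fin 3)) | ∀ i ∈ S, ∀ j ∈ S, i ≠ j → ∀ r ∈ Set.Icc (0 : ℝ) (τ N), Literature.MathematicalPhysics.KineticTheory.hsDiameter σ N ≤ ‖(Literature.Analysis.FluidPDE.Torus.geometry (Fin 3)).sepVec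 (Literature.Analysis.FluidPDE.freeFlight (Literature.Analysis.FluidPDE.Torus.geometry (Fin 3)) r z i).1 (Literature.Analysis.FluidPDE.freeFlight (Literature.Analysis.FluidPDE.Torus.geometry (Fin 3)) r z j).1‖} ≤ ENNReal.ofReal (Real.exp (-(c * ((N + 1 : ℕ) : ℝ)))))) →
    (∀ σ : ℝ, 0 < σ → σ < 2⁻¹ → (∀ (N : ℕ) (Φ : Literature.Analysis.FluidPDE.HardSphereFlow (Literature.Analysis.FluidPDE.Torus.geometry (Fin 3)) (Literature.MathematicalPhysics.KineticTheory.hsDiameter σ N) (N + 1)) (t : ℝ), MeasureTheory.MeasurePreserving (Φ.flow t) (Literature.MathematicalPhysics.KineticTheory.localGibbsLaw σ (fun _ => 1) (fun _ => 0) (fun _ => 1) N Φ) (Literature.MathematicalPhysics.KineticTheory.localGibbsLaw σ (fun _ => 1) (fun _ => 0) (fun _ => 1) N Φ)) → (∀ τ : ℕ → ℝ, (∀ N, 0 < τ N) → Tendsto (fun N : ℕ => τ N * ((N + 1 : ℕ) : ℝ) ^ ((1 : ℝ) / 3)) atTop atTop → ∀ η : ℝ, 0 < η → ∀ c : ℝ,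 ∀ᶠ N : ℕ in atTop, ∀ (Φ : Literature.Analysis.FluidPDE.HardSphereFlow (Literature.Analysis.FluidPDE.Torus.geometry (Fin 3)) (Literature.MathematicalPhysics.KineticTheory.hsDiameter σ N) (N + 1)) (S : Finset (Fin (N + 1))), η * ((N + 1 : ℕ) : ℝ) ≤ (S.card : ℝ) → Literature.MathematicalPhysics.KineticTheory.localGibbsLaw σ (fun _ => 1) (fun _ => 0) (fun _ => 1) N Φ {z : Literature.Analysis.FluidPDE.Config (N + 1) (Fin 3) (UnitAddTorus (Fin 3)) | ∀ i ∈ S, ∀ j ∈ S, i ≠ j → ∀ r ∈ Set.Icc (0 : ℝ) (τ N), Literature.MathematicalPhysics.KineticTheory.hsDiameter σ N ≤ ‖(Literature.Analysis.FluidPDE.Torus.geometry (Fin 3)).sepVec (Literature.Analysis.FluidPDE.freeFlight (Literature.Analysis.FluidPDE.Torus.geometry (Fin 3)) r z i).1 (Literature.Analysis.FluidPDE.freeFlight (Literature.Analysis.FluidPDE.Torus.geometry (Fin 3)) r z j).1‖} ≤ ENNReal.ofReal (Real.exp (-(c * ((N + 1 : ℕ) : ℝ))))) → let ownColl := fun (N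 : ℕ) (y : Literature.Analysis.FluidPDE.Config (N + 1) (Fin 3) (UnitAddTorus (Fin 3))) (Δ : ℝ) (i : Fin (N + 1)) => (let G := Literature.Analysis.FluidPDE.Torus.geometry (Fin 3); let ε : ℝ := Literature.MathematicalPhysics.KineticTheory.hsDiameter σ N; let pre := fun k : ℕ => (let zk := Literature.Analysis.FluidPDE.Alexander.stateAfter G ε y k; Literature.Analysis.FluidPDE.freeFlight G (Literature.Analysis.FluidPDE.Alexander.freeExitTime G ε zk).toReal zk); ((Finset.range (Literature.Analysis.FluidPDE.Alexander.collisionCount G ε y Δ)).filter (fun k => ∃ h : (Literature.Analysis.FluidPDE.Alexander.incomingPairs G ε (pre k)).Nonempty, h.some.1 = i ∨ h.some.2 = i)).card); ∀ Δ : ℕ → ℝ, (∀ N, 0 < Δ N) → Tendsto (fun N : ℕ => Δ N * ((N + 1 : ℕ) : ℝ) ^ ((1 : ℝ) / 3)) atTop atTop → ∀ (m : ℕ) (η : ℝ), 0 < η → ∀ c : ℝ, ∀ᶠ N : ℕ in atTop, ∀ Φ : Literature.Analysis.FluidPDE.HardSphereFlow (Literature.Analysis.FluidPDE.Torus.geometry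 (Fin 3)) (Literature.MathematicalPhysics.KineticTheory.hsDiameter σ N) (N + 1), Literature.MathematicalPhysics.KineticTheory.localGibbsLaw σ (fun _ => 1) (fun _ => 0) (fun _ => 1) N Φ {y : Literature.Analysis.FluidPDE.Config (N + 1) (Fin 3) (UnitAddTorus (Fin 3)) | η * ((N + 1 : ℕ) : ℝ) ≤ ((Finset.univ.filter (fun i : Fin (N + 1) => ownColl N y (Δ N) i ≤ m)).card : ℝ)} ≤ ENNReal.ofReal (Real.exp (-(c * ((N + 1 : ℕ) : ℝ))))) →
    (∃ σ₀ : ℝ, 0 < σ₀ ∧ ∀ σ : ℝ, 0 < σ → σ < σ₀ → (∀ (N : ℕ) (Φ : Literature.Analysis.FluidPDE.HardSphereFlow (Literature.Analysis.FluidPDE.Torus.geometry (Fin 3)) (Literature.MathematicalPhysics.KineticTheory.hsDiameter σ N) (N + 1)) (t : ℝ), MeasureTheory.MeasurePreserving (Φ.flow t) (Literature.MathematicalPhysics.KineticTheory.localGibbsLaw σ (fun _ => 1) (fun _ => 0) (fun _ => 1) N Φ) (Literature.MathematicalPhysics.KineticTheory.localGibbsLaw σ (fun _ => 1) (fun _ =>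 0) (fun _ => 1) N Φ)) → let M := fun (N : ℕ) (y : Literature.Analysis.FluidPDE.Config (N + 1) (Fin 3) (UnitAddTorus (Fin 3))) (Δ : ℝ) (W : Fin (N + 1) → EuclideanSpace ℝ (Fin 3)) => (let G := Literature.Analysis.FluidPDE.Torus.geometry (Fin 3); let ε : ℝ := Literature.MathematicalPhysics.KineticTheory.hsDiameter σ N; let pre := fun k : ℕ => (let zk := Literature.Analysis.FluidPDE.Alexander.stateAfter G ε y k; Literature.Analysis.FluidPDE.freeFlight G (Literature.Analysis.FluidPDE.Alexander.freeExitTime G ε zk).toReal zk); (List.range (Literature.Analysis.FluidPDE.Alexander.collisionCount G ε y Δ)).foldl (fun W' k => @dite (Fin (N + 1) → EuclideanSpace ℝ (Fin 3)) (Literature.Analysis.FluidPDE.Alexander.incomingPairs G ε (pre k)).Nonempty (Classical.propDecidable _) (fun h => fun i => (Literature.Analysis.FluidPDE.collidePair G h.some.1 h.some.2 (fun j => ((pre k j).1, W' j)) i).2) (fun _ => W')) W); let ipr := fun N y Δ => ((N + 1 : ℕ) : ℝ)⁻¹ * ∑ i : Fin (N + 1), ∑ k : Fin (N + 1), (∑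 a : Fin 3, ‖M N y Δ (Pi.single k (EuclideanSpace.single a (1 : ℝ))) i‖ ^ 2) ^ 2; let ownColl := fun (N : ℕ) (y : Literature.Analysis.FluidPDE.Config (N + 1) (Fin 3) (UnitAddTorus (Fin 3))) (Δ : ℝ) (i : Fin (N + 1)) => (let G := Literature.Analysis.FluidPDE.Torus.geometry (Fin 3); let ε : ℝ := Literature.MathematicalPhysics.KineticTheory.hsDiameter σ N; let pre := fun k : ℕ => (let zk := Literature.Analysis.FluidPDE.Alexander.stateAfter G ε y k; Literature.Analysis.FluidPDE.freeFlight G (Literature.Analysis.FluidPDE.Alexander.freeExitTime G ε zk).toReal zk); ((Finset.range (Literature.Analysis.FluidPDE.Alexander.collisionCount G ε y Δ)).filter (fun k => ∃ h : (Literature.Analysis.FluidPDE.Alexander.incomingPairs G ε (pre k)).Nonempty, h.some.1 = i ∨ h.some.2 = i)).card); (∀ Δ : ℕ → ℝ, (∀ N, 0 < Δ N) → Tendsto (fun N : ℕ => Δ N * ((N + 1 : ℕ) : ℝ) ^ ((1 : ℝ) / 3)) atTop atTop → ∀ (m : ℕ) (η : ℝ), 0 < η → ∀ c : ℝ, ∀ᶠ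 N : ℕ in atTop, ∀ Φ : Literature.Analysis.FluidPDE.HardSphereFlow (Literature.Analysis.FluidPDE.Torus.geometry (Fin 3)) (Literature.MathematicalPhysics.KineticTheory.hsDiameter σ N) (N + 1), Literature.MathematicalPhysics.KineticTheory.localGibbsLaw σ (fun _ => 1) (fun _ => 0) (fun _ => 1) N Φ {y : Literature.Analysis.FluidPDE.Config (N + 1) (Fin 3) (UnitAddTorus (Fin 3)) | η * ((N + 1 : ℕ) : ℝ) ≤ ((Finset.univ.filter (fun i : Fin (N + 1) => ownColl N y (Δ N) i ≤ m)).card : ℝ)} ≤ ENNReal.ofReal (Real.exp (-(c * ((N + 1 : ℕ) : ℝ))))) → ∀ Δ : ℕ → ℝ, (∀ N, 0 < Δ N) → Tendsto Δ atTop (𝓝 0) → Tendsto (fun N : ℕ => Δ N * ((N + 1 : ℕ) : ℝ) ^ ((1 : ℝ) / 3)) atTop atTop → ∀ δ : ℝ, 0 < δ → ∀ c : ℝ, ∀ᶠ N : ℕ in atTop, ∀ Φ : Literature.Analysis.FluidPDE.HardSphereFlow (Literature.Analysis.FluidPDE.Torus.geometry (Fin 3)) (Literature.MathematicalPhysics.KineticTheory.hsDiameter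 σ N) (N + 1), Literature.MathematicalPhysics.KineticTheory.localGibbsLaw σ (fun _ => 1) (fun _ => 0) (fun _ => 1) N Φ {y : Literature.Analysis.FluidPDE.Config (N + 1) (Fin 3) (UnitAddTorus (Fin 3)) | δ < ipr N y (Δ N)} ≤ ENNReal.ofReal (Real.exp (-(c * ((N + 1 : ℕ) : ℝ))))) →
    Summit.AtomisticToContinuum.HydrodynamicLimit.Theses.CollisionIsometryCLT.DiffuseBackwardInfluence := by
  intro hT hInv hEnt hTube hFew hRec a₀ θ₀ u₀ ha hθ hu ha0 hθ0
  obtain ⟨σ₁, hσ₁, H1⟩ := hEnt a₀ θ₀ u₀ ha hθ hu ha0 hθ0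
  obtain ⟨σ₂, hσ₂, H2⟩ := hTube
  obtain ⟨σ₃, hσ₃, H3⟩ := hRec
  refine ⟨min (min σ₁ σ₂) (min σ₃ 2⁻¹), lt_min (lt_min hσ₁ hσ₂) (lt_min hσ₃ (by norm_num)),
    fun σ hσ hσlt Φ Δ hΔpos hΔ0 hΔinf t ht => ?_⟩
  have hlt1 : σ < σ₁ := lt_of_lt_of_le hσlt ((min_le_left _ _).trans (min_le_left _ _))
  have hlt2 : σ < σ₂ := lt_of_lt_of_le hσlt ((min_le_left _ _).trans (min_le_right _ _))
  have hlt3 : σ < σ₃ := lt_of_lt_of_le hσlt ((min_le_right _ _).trans (min_le_left _ _))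
  have hlth : σ < 2⁻¹ := lt_of_lt_of_le hσlt ((min_le_right _ _).trans (min_le_right _ _))
  -- Gibbs invariance at `θe = 1` (stub 1), in the form consumed by stubs 4 and 5
  have hInvσ : ∀ (N : ℕ) (Ψ : Literature.Analysis.FluidPDE.HardSphereFlow
      (Literature.Analysis.FluidPDE.Torus.geometry (Fin 3))
      (Literature.MathematicalPhysics.KineticTheory.hsDiameter σ N) (N + 1)) (s : ℝ),
      MeasureTheory.MeasurePreserving (Ψ.flow s)
        (Literature.MathematicalPhysics.KineticTheory.localGibbsLaw σ (fun _ => 1) (fun _ => 0) (fun _ => 1) N Ψ)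
        (Literature.MathematicalPhysics.KineticTheory.localGibbsLaw σ (fun _ => 1) (fun _ => 0) (fun _ => 1) N Ψ) :=
    fun N Ψ s => hInv σ 1 N Ψ s one_pos
  -- few collisions are super-exponentially rare, for every admissible window (stubs 1 + 3 ⇒ stub 4)
  have hFewσ := hFew σ hσ hlth hInvσ (H2 σ hσ hlt2)
  -- the equilibrium super-exponential delocalisation on the window `Δ` (stub 5)
  have hSup := H3 σ hσ hlt3 hInvσ hFewσ Δ hΔpos hΔ0 hΔinf
  -- the entropy transfer (stub 2) with `F N z := ipr N (Φ_{t - Δ N} z) (Δ N)` and `B := 9`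
  refine H1 σ hσ hlt1 Φ _ 9 (fun N z => ?_) (fun N z => ?_) (fun δ hδ c => ?_)
  · -- `0 ≤ ipr`
    beta_reduce
    positivity
  · -- `ipr ≤ 9` from the row budget of `TransferIsometry`
    beta_reduce
    obtain ⟨-, -, -, hrow⟩ := hT σ N ((Φ N).flow (t - Δ N) z) (Δ N)
    beta_reduce at hrow
    exact avg_ipr_le_nine _ hrow
  · -- transport of the time-`(t - Δ N)` event to a `G_N`-event by invariance, then stub 5
    filter_upwards [hSup δ hδ c] with N hN
    exact measure_setOf_comp_le_of_le ((Φ N).measurable_flow (t - Δ N)) (hInvσ N (Φ N) (t - Δ N)).map_eq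
      (hN (Φ N))


/-- The same composition with the five stubs plugged in BY NAME: conditional only on the route's support item
`TransferIsometry` (stmt-AtomisticToContinuum-12951, provable-now). Once the stubs are proved this is a closed proof of the
crux decl. -/
theorem DiffuseBackwardInfluence_of_stubs
    (hT : Summit.AtomisticToContinuum.HydrodynamicLimit.Theses.CollisionIsometryCLT.TransferIsometry) :
    Summit.AtomisticToContinuum.HydrodynamicLimit.Theses.CollisionIsometryCLT.DiffuseBackwardInfluence :=
  DiffuseBackwardInfluence_of hT stub_gibbsInvariance stub_entropyTransfer stub_tubeNonCrossingLD
    stub_fewCollisionsOfTubes stub_noReconcentration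

end Summit.AtomisticToContinuum.HydrodynamicLimit.Cruxes.DiffuseBackwardInfluence.BallisticTubes
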